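import Literature.NumberTheory.LFunctions.Zhang2022.Section8XiDipoleSuperposition
import Literature.NumberTheory.LFunctions.Zhang2022.Section8DipoleTaylor
import HarnessLib

/-!
# Zhang (2022) §8: the MASS RULE for a `C²` piece — twisted Taylor at the far endpoint and the main-term identity
# `−W′(Z)𝔤(Z) + ∫₀^Z 𝔤·(W″ − 2γW′ + γ²W) = −W′(0) + (C + γ + γA)W(0) + γ²A∫₀^Z W` for `𝔤(y) = A + (1 − A + Cy)e^{−γy}`

Topic `Literature/NumberTheory/LFunctions/Zhang2022` (Landau–Siegel audit tree; verdict-neutral). Y. Zhang, *Discrete mean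
estimates and the Landau–Siegel zero*, arXiv:2211.02515v1 (2022) [Zhang2022LandauSiegel] — **an unrefereed manuscript
under adjudication; nothing here asserts or denies its Theorems 1–2; no claim about Landau–Siegel zeros.** Cell
landau-siegel §D, crux K0 = stmt-Parity-20459, prover ls-knife-K0-p1 g0. Companion of `Section8XiDipoleSuperposition` (the
anti-side transfer engine, LEMMA A* of K1″a DISPLAY #5 §1): the CALLER's bookkeeping for one `C²` piece.

* `twTaylor` — for `W, W′` continuous on `[0,Z]`, right derivatives `W′, W″` inside, `W″` integrable, `W(Z) = 0`, and any
  `γ ∈ ℂ`: `W(z) = −W′(Z)·(Z−z)₊e^{−γ(Z−z)} + ∫₀^Z (y−z)₊e^{−γ(y−z)}ρ(y)dy` on `[0,Z]` with `ρ = W″ − 2γW′ + γ²W` — i.e.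
  `W = twSuperposedWeight γ ![−W′(Z)] ![Z] Z ρ` (Taylor for `Ψ = e^{−γy}W` via `taylor_ramp`);
* `massRule_identity` — for the Lemma-8.4-shaped main-term profile `𝔤(y) = A + (1 − A + C·y)e^{−γy}` (Zhang's
  `𝔤_{jμ}(e^{yΛ})`: `A = β′β″/β_μ²`, `C = −(β′−β_μ)(β″−β_μ)Λ/β_μ`, `γ = β_μΛ`):
  `−W′(Z)𝔤(Z) + ∫₀^Z 𝔤(y)ρ(y)dy = −W′(0) + (C + γ + γA)·W(0) + γ²A·∫₀^Z W` — one fundamental theorem of calculus for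
  `Φ = 𝔤W′ − 𝔤′W − 2γ𝔤W` and the pointwise identity `𝔤″ + 2γ𝔤′ + γ²𝔤 = γ²A`. With Zhang's constants,
  `C + γ + γA = Λ(β′+β″)` and `γ²A = Λ²β′β″` (`massRule_constants`), so the right side is DISPLAY #5's mass rule
  `Λ⁻¹·[−W′(0)·Λ⁰ …]` = `−W′(0) + Λ(β′+β″)W(0) + Λ²β′β″∫W` = `Λ·𝔪(b′+b″, b′b″; w)(z_t)` in profile units.

## References
* Y. Zhang, arXiv:2211.02515v1 (2022), §8 Lemmas 8.3–8.4, pp. 16–17. [cite: Zhang2022LandauSiegel, §8 Lemma 8.4]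
-/

noncomputable section

open Complex Real Finset MeasureTheory intervalIntegral Set

namespace Literature.NumberTheory.LFunctions.Zhang2022.DipoleRule

/-! ### Twisted Taylor at the far endpoint -/

/-- `d/dy e^{−γy} = −γe^{−γy}` (real variable, complex `γ`). [folklore] -/
private theorem hasDerivAt_expNeg (γ : ℂ) (y : ℝ) :
    HasDerivAt (fun y : ℝ => Complex.exp (-(γ * (y : ℂ)))) (-γ * Complex.exp (-(γ * (y : ℂ)))) y := by
  have h0 : HasDerivAt (fun y : ℝ => (y : ℂ)) 1 y := by simpa using (hasDerivAt_id y).ofReal_comp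
  have h1 : HasDerivAt (fun y : ℝ => -(γ * (y : ℂ))) (-(γ * 1)) y := (h0.const_mul γ).neg
  have h2 := h1.cexp
  exact h2.congr_deriv (by ring)

/-- `d/dy (a + C·y) = C` (real variable, complex constants). [folklore] -/
private theorem hasDerivAt_affine (a C : ℂ) (y : ℝ) : HasDerivAt (fun y : ℝ => a + C * (y : ℂ)) C y := by
  have h0 : HasDerivAt (fun y : ℝ => (y : ℂ)) 1 y := by simpa using (hasDerivAt_id y).ofReal_comp
  have h1 := (h0.const_mul C).const_add a
  exact h1.congr_deriv (by ring)


/-- **Twisted Taylor, ramp form:** `W(z) = −W′(Z)·tramp γ Z z + ∫₀^Z tramp γ y z·ρ(y)dy` on `[0,Z]`,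
`ρ = W″ − 2γW′ + γ²W`, for `W, W′` continuous on `[0,Z]` with right derivatives `W′, W″` inside, `W″` integrable,
`W(Z) = 0`. [cite: Zhang2022LandauSiegel, §8 Lemma 8.4] -/
theorem twTaylor (γ : ℂ) {W W' W'' : ℝ → ℂ} {Z : ℝ} (hW : ContinuousOn W (Icc 0 Z)) (hW' : ContinuousOn W' (Icc 0 Z))
    (hd : ∀ y ∈ Ioo 0 Z, HasDerivWithinAt W (W' y) (Ioi y) y)
    (hd' : ∀ y ∈ Ioo 0 Z, HasDerivWithinAt W' (W'' y) (Ioi y) y)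
    (hint : IntervalIntegrable W'' volume 0 Z) (hWZ : W Z = 0) {z : ℝ} (hz : z ∈ Icc 0 Z) :
    W z = twSuperposedWeight γ ![-W' Z] ![Z] Z (fun y => W'' y - 2 * γ * W' y + γ ^ 2 * W y) z := by
  have hZ : 0 ≤ Z := hz.1.trans hz.2
  -- `Ψ = e^{−γy}W` and its derivatives
  set E : ℝ → ℂ := fun y => Complex.exp (-(γ * (y : ℂ))) with hE
  set Ψ : ℝ → ℂ := fun y => E y * W y with hΨ
  set Ψ' : ℝ → ℂ := fun y => E y * (W' y - γ * W y) with hΨ'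
  set Ψ'' : ℝ → ℂ := fun y => E y * (W'' y - 2 * γ * W' y + γ ^ 2 * W y) with hΨ''
  have hEc : Continuous E := Complex.continuous_exp.comp ((continuous_const.mul Complex.continuous_ofReal).neg)
  have hEd : ∀ y : ℝ, HasDerivAt E (-γ * E y) y := fun y => hasDerivAt_expNeg γ y
  have hΨc : ContinuousOn Ψ (Icc 0 Z) := hEc.continuousOn.mul hW
  have hΨ'c : ContinuousOn Ψ' (Icc 0 Z) := hEc.continuousOn.mul (hW'.sub (continuousOn_const.mul hW))
  have hΨd : ∀ y ∈ Ioo 0 Z, HasDerivWithinAt Ψ (Ψ' y) (Ioi y) y := by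
    intro y hy
    have h := ((hEd y).hasDerivWithinAt (s := Ioi y)).mul (hd y hy)
    have e : -γ * E y * W y + E y * W' y = Ψ' y := by simp only [hΨ']; ring
    rw [← e]; exact h
  have hΨ'd : ∀ y ∈ Ioo 0 Z, HasDerivWithinAt Ψ' (Ψ'' y) (Ioi y) y := by
    intro y hy
    have h := ((hEd y).hasDerivWithinAt (s := Ioi y)).mul
      ((hd' y hy).sub ((hd y hy).const_mul γ))
    have e : -γ * E y * (W' y - γ * W y) + E y * (W'' y - γ * W' y) = Ψ'' y := by simp only [hΨ'']; ring
    rw [← e]; exact h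
  have hΨ''i : IntervalIntegrable Ψ'' volume 0 Z := by
    have h1 : IntervalIntegrable (fun y => W'' y - 2 * γ * W' y + γ ^ 2 * W y) volume 0 Z := by
      refine (hint.sub ?_).add ?_
      · exact (ContinuousOn.intervalIntegrable (by rw [Set.uIcc_of_le hZ]; exact continuousOn_const.mul hW'))
      · exact (ContinuousOn.intervalIntegrable (by rw [Set.uIcc_of_le hZ]; exact continuousOn_const.mul hW))
    exact h1.continuousOn_mul hEc.continuousOn
  have hΨZ : Ψ Z = 0 := by simp [hΨ, hWZ]
  have key := taylor_ramp hΨc hΨ'c hΨd hΨ'd hΨ''i hΨZ hz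
  -- multiply by `e^{γz}` and unfold
  have hEz : E z * Complex.exp (γ * (z : ℂ)) = 1 := by
    rw [hE, ← Complex.exp_add]; simp
  have hEmul : ∀ y : ℝ, Complex.exp (γ * (z : ℂ)) * E y = Complex.exp (-(γ * ((y - z : ℝ) : ℂ))) := by
    intro y; rw [hE, ← Complex.exp_add]; congr 1; push_cast; ring
  have hWz : W z = Complex.exp (γ * (z : ℂ)) * Ψ z := by
    rw [hΨ]; simp only; rw [← mul_assoc, mul_comm (Complex.exp _), hEz, one_mul]
  rw [hWz, key]
  unfold twSuperposedWeight tramp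
  rw [Fin.sum_univ_one, Matrix.cons_val_zero, Matrix.cons_val_zero, mul_add,
    ← intervalIntegral.integral_const_mul]
  congr 1
  · simp only [hΨ', hWZ, mul_zero, sub_zero]
    rw [← hEmul Z]; ring
  · refine intervalIntegral.integral_congr fun y _ => ?_
    simp only [hΨ'']
    rw [← hEmul y]; ring

/-! ### The main-term identity (mass rule) -/

/-- Lemma 8.4's main-term profile in the height variable: `𝔤(y) = A + (1 − A + C·y)e^{−γy}` (`𝔤(0) = 1`).
[cite: Zhang2022LandauSiegel, §8 Lemma 8.4] -/
def gProfile (A C γ : ℂ) (y : ℝ) : ℂ := A + (1 - A + C * (y : ℂ)) * Complex.exp (-(γ * (y : ℂ)))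

/-- `𝔤′(y) = (C − γ(1 − A + Cy))e^{−γy}`. [cite: Zhang2022LandauSiegel, §8 Lemma 8.4] -/
def gProfile' (A C γ : ℂ) (y : ℝ) : ℂ := (C - γ * (1 - A + C * (y : ℂ))) * Complex.exp (-(γ * (y : ℂ)))

/-- `𝔤″(y) = (γ²(1 − A + Cy) − 2γC)e^{−γy}`. [cite: Zhang2022LandauSiegel, §8 Lemma 8.4] -/
def gProfile'' (A C γ : ℂ) (y : ℝ) : ℂ :=
  (γ ^ 2 * (1 - A + C * (y : ℂ)) - 2 * γ * C) * Complex.exp (-(γ * (y : ℂ)))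

/-- The derivative of `𝔤`. [cite: Zhang2022LandauSiegel, §8 Lemma 8.4] -/
theorem hasDerivAt_gProfile (A C γ : ℂ) (y : ℝ) : HasDerivAt (gProfile A C γ) (gProfile' A C γ y) y := by
  have hE := hasDerivAt_expNeg γ y
  have hlin := hasDerivAt_affine (1 - A) C y
  have h : HasDerivAt (fun y : ℝ => A + (1 - A + C * (y : ℂ)) * Complex.exp (-(γ * (y : ℂ))))
      (C * Complex.exp (-(γ * (y : ℂ))) + (1 - A + C * (y : ℂ)) * (-γ * Complex.exp (-(γ * (y : ℂ))))) y :=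
    (hlin.mul hE).const_add A
  unfold gProfile gProfile'
  exact h.congr_deriv (by ring)

/-- The derivative of `𝔤′`. [cite: Zhang2022LandauSiegel, §8 Lemma 8.4] -/
theorem hasDerivAt_gProfile' (A C γ : ℂ) (y : ℝ) : HasDerivAt (gProfile' A C γ) (gProfile'' A C γ y) y := by
  have hE := hasDerivAt_expNeg γ y
  have hlin : HasDerivAt (fun y : ℝ => C - γ * (1 - A + C * (y : ℂ))) (-(γ * C)) y := by
    have := ((hasDerivAt_affine (1 - A) C y).const_mul γ).const_sub C
    exact this.congr_deriv (by ring)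
  have h : HasDerivAt (fun y : ℝ => (C - γ * (1 - A + C * (y : ℂ))) * Complex.exp (-(γ * (y : ℂ))))
      (-(γ * C) * Complex.exp (-(γ * (y : ℂ))) + (C - γ * (1 - A + C * (y : ℂ))) * (-γ * Complex.exp (-(γ * (y : ℂ))))) y :=
    hlin.mul hE
  unfold gProfile' gProfile''
  exact h.congr_deriv (by ring)

/-- `𝔤(0) = 1`. [cite: Zhang2022LandauSiegel, §8 Lemma 8.4] -/
theorem gProfile_zero (A C γ : ℂ) : gProfile A C γ 0 = 1 := by simp [gProfile]

/-- `𝔤′(0) = C − γ(1 − A)`. [cite: Zhang2022LandauSiegel, §8 Lemma 8.4] -/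
theorem gProfile'_zero (A C γ : ℂ) : gProfile' A C γ 0 = C - γ * (1 - A) := by simp [gProfile']

/-- The conjugation identity `𝔤″ + 2γ𝔤′ + γ²𝔤 = γ²A` (the twisted factor is annihilated by `(∂+γ)²`).
[cite: Zhang2022LandauSiegel, §8 Lemma 8.4] -/
theorem gProfile_ode (A C γ : ℂ) (y : ℝ) :
    gProfile'' A C γ y + 2 * γ * gProfile' A C γ y + γ ^ 2 * gProfile A C γ y = γ ^ 2 * A := by
  unfold gProfile gProfile' gProfile''
  ring

/-- **THE MASS-RULE IDENTITY:** for `W, W′` continuous on `[0,Z]` with right derivatives `W′, W″` inside, `W″` integrable,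
`W(Z) = 0`: `−W′(Z)𝔤(Z) + ∫₀^Z 𝔤(y)(W″ − 2γW′ + γ²W)(y)dy = −W′(0) + (C + γ + γA)W(0) + γ²A∫₀^Z W` — the superposed main
term of `xiDipole_superposed` for the twisted Taylor data of `twTaylor` IS the mass rule.
[cite: Zhang2022LandauSiegel, §8 Lemma 8.4] -/
theorem massRule_identity (A C γ : ℂ) {W W' W'' : ℝ → ℂ} {Z : ℝ} (hZ : 0 ≤ Z) (hW : ContinuousOn W (Icc 0 Z))
    (hW' : ContinuousOn W' (Icc 0 Z)) (hd : ∀ y ∈ Ioo 0 Z, HasDerivWithinAt W (W' y) (Ioi y) y)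
    (hd' : ∀ y ∈ Ioo 0 Z, HasDerivWithinAt W' (W'' y) (Ioi y) y) (hint : IntervalIntegrable W'' volume 0 Z)
    (hWZ : W Z = 0) :
    -W' Z * gProfile A C γ Z + ∫ y in (0:ℝ)..Z, gProfile A C γ y * (W'' y - 2 * γ * W' y + γ ^ 2 * W y)
      = -W' 0 + (C + γ + γ * A) * W 0 + γ ^ 2 * A * ∫ y in (0:ℝ)..Z, W y := by
  set G := gProfile A C γ with hG
  set G' := gProfile' A C γ with hG'
  set G'' := gProfile'' A C γ with hG''
  -- Φ = G W′ − G′ W − 2γ G W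
  set Φ : ℝ → ℂ := fun y => G y * W' y - G' y * W y - 2 * γ * G y * W y with hΦ
  have hGc : Continuous G := by
    have : ∀ y, HasDerivAt G (G' y) y := hasDerivAt_gProfile A C γ
    exact continuous_iff_continuousAt.mpr fun y => (this y).continuousAt
  have hG'c : Continuous G' := by
    have : ∀ y, HasDerivAt G' (G'' y) y := hasDerivAt_gProfile' A C γ
    exact continuous_iff_continuousAt.mpr fun y => (this y).continuousAt
  have hΦc : ContinuousOn Φ (Icc 0 Z) :=
    ((hGc.continuousOn.mul hW').sub (hG'c.continuousOn.mul hW)).sub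
      ((continuousOn_const.mul hGc.continuousOn).mul hW)
  -- Φ′ = G W″ − 2γ G W′ − (G″ + 2γ G′) W
  have hΦd : ∀ y ∈ Ioo 0 Z, HasDerivWithinAt Φ
      (G y * W'' y - 2 * γ * G y * W' y - (G'' y + 2 * γ * G' y) * W y) (Ioi y) y := by
    intro y hy
    have h1 := ((hasDerivAt_gProfile A C γ y).hasDerivWithinAt (s := Ioi y)).mul (hd' y hy)
    have h2 := ((hasDerivAt_gProfile' A C γ y).hasDerivWithinAt (s := Ioi y)).mul (hd y hy)
    have h3 := (((hasDerivAt_gProfile A C γ y).hasDerivWithinAt (s := Ioi y)).const_mul (2 * γ)).mul (hd y hy)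
    have h : HasDerivWithinAt (fun y => G y * W' y - G' y * W y - 2 * γ * G y * W y)
        ((G' y * W' y + G y * W'' y) - (G'' y * W y + G' y * W' y)
          - (2 * γ * G' y * W y + 2 * γ * G y * W' y)) (Ioi y) y := (h1.sub h2).sub h3
    exact h.congr_deriv (by ring)
  -- integrand = Φ′ + γ²A·W
  have hsplit : ∀ y : ℝ, G y * (W'' y - 2 * γ * W' y + γ ^ 2 * W y)
      = (G y * W'' y - 2 * γ * G y * W' y - (G'' y + 2 * γ * G' y) * W y) + γ ^ 2 * A * W y := by
    intro y
    have := gProfile_ode A C γ y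
    rw [← hG, ← hG', ← hG''] at this
    linear_combination (W y) * this
  have hWi : IntervalIntegrable W volume 0 Z := by
    exact ContinuousOn.intervalIntegrable (by rw [Set.uIcc_of_le hZ]; exact hW)
  have hW'i : IntervalIntegrable W' volume 0 Z := by
    exact ContinuousOn.intervalIntegrable (by rw [Set.uIcc_of_le hZ]; exact hW')
  have hΦ'i : IntervalIntegrable (fun y => G y * W'' y - 2 * γ * G y * W' y - (G'' y + 2 * γ * G' y) * W y)
      volume 0 Z := by
    have hG''c : Continuous G'' := by
      unfold gProfile'' at hG''; rw [hG'']
      exact ((continuous_const.mul (continuous_const.add (continuous_const.mul Complex.continuous_ofReal))).sub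
        continuous_const).mul (Complex.continuous_exp.comp ((continuous_const.mul Complex.continuous_ofReal).neg))
    refine ((hint.continuousOn_mul hGc.continuousOn).sub ?_).sub ?_
    · exact hW'i.continuousOn_mul (continuousOn_const.mul hGc.continuousOn)
    · exact hWi.continuousOn_mul ((hG''c.add (continuous_const.mul hG'c)).continuousOn)
  have hint_eq : (∫ y in (0:ℝ)..Z, G y * (W'' y - 2 * γ * W' y + γ ^ 2 * W y))
      = (Φ Z - Φ 0) + γ ^ 2 * A * ∫ y in (0:ℝ)..Z, W y := by
    simp_rw [hsplit]
    rw [intervalIntegral.integral_add hΦ'i (hWi.const_mul _), intervalIntegral.integral_const_mul,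
      intervalIntegral.integral_eq_sub_of_hasDeriv_right_of_le hZ hΦc hΦd hΦ'i]
  rw [hint_eq]
  simp only [hΦ, hWZ, mul_zero, sub_zero, hG, hG', gProfile_zero, gProfile'_zero]
  ring

/-- **Zhang's constants:** with `A = β′β″/β_μ²`, `C = −(β′−β_μ)(β″−β_μ)Λ/β_μ`, `γ = β_μΛ` (`β_μ ≠ 0`):
`C + γ + γA = Λ(β′+β″)` and `γ²A = Λ²β′β″` — the mass rule's coefficients `(b′+b″, b′b″)` in `α`-units.
[cite: Zhang2022LandauSiegel, §8 Lemma 8.4] -/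
theorem massRule_constants (β1 β2 βμ Λ : ℂ) (hβ : βμ ≠ 0) :
    (-((β1 - βμ) * (β2 - βμ)) * Λ / βμ) + βμ * Λ + βμ * Λ * (β1 * β2 / βμ ^ 2) = Λ * (β1 + β2) ∧
    (βμ * Λ) ^ 2 * (β1 * β2 / βμ ^ 2) = Λ ^ 2 * (β1 * β2) := by
  constructor
  · field_simp
    ring
  · field_simp

/-- **Zhang's `𝔤_{jμ}` IS `gProfile` in the height variable**: `frakg β′ β″ β_μ (yΛ) = gProfile (β′β″/β_μ²)
(−(β′−β_μ)(β″−β_μ)Λ/β_μ) (β_μΛ) y`. [cite: Zhang2022LandauSiegel, §8 Lemma 8.4] -/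
theorem frakg_eq_gProfile (β1 β2 βμ : ℂ) (Λ y : ℝ) :
    frakg β1 β2 βμ ((y : ℂ) * Λ)
      = gProfile (β1 * β2 / βμ ^ 2) (-((β1 - βμ) * (β2 - βμ)) * Λ / βμ) (βμ * Λ) y := by
  unfold frakg gProfile
  have e1 : Complex.exp (-(βμ * ((y : ℂ) * Λ))) = Complex.exp (-(βμ * (Λ : ℂ) * (y : ℂ))) := by ring_nf
  rw [e1]
  ring

end Literature.NumberTheory.LFunctions.Zhang2022.DipoleRule

end
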